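import Summits.KontsevichZagierPeriods.Zeta5Search.Certificates.RayC1KernelPeriodicClass
import Summits.KontsevichZagierPeriods.Zeta5Search.Certificates.RayC1KernelAtlasWinA
import HarnessLib

/-!
# ζ(5) search — certificates: the BRIDGE from fam-denom's route-(A) periodic cell rows (four parity classes) to one `PWin.Holds` (CERT-1 g6)

HONEST FRAMING: systematic search; no irrationality claim unless certified.  Integer bookkeeping of explicit valuations; nothing
here is a statement about `ζ(5)`; every exponent this feeds is `< 1` (calibration ladder of the T1-map ray C1; no crossing claimed).

OUR work (Summit side; cert-1 seat, generation 6; the lead's ruling 2026-08-22T01:18Z: "typer/cert-1's `c1_exponent_of_tables` consumes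
rows through the `PWin.Holds` bridge").  fam-denom g14's route-(A) row files (`Zeta5Search/RayC1PeriodicCell<NNN>.lean`, kit
`PeriodicCellKit`) prove, for each Farey cell `y = n/p − m ∈ [u₁/u₂, v₁/v₂)` and each PARITY CLASS `(n mod 2, m = b₁ + 2t)`, a bound
`RayC1Periodic.C<cell><E|O><b₁>.bound : B − 256·(b₁ + 2t) ≤ v_p(Cas₇(bRay β1 n))` on the window
`(u₂b₁ + u₁)p + 2u₂(tp) < u₂n`, `v₂n < (v₂b₁ + v₁)p + 2v₂(tp)`.  The periodic consumer (`RayC1KernelPeriodicClass.psound_class`)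
reads fam-rv's `PWin.Holds` (all `m ≥ 1`, all parities, non-strict left end, `bC1`).  This file is the generic glue:
* `DBound₁ u1 u2 v1 v2 r B`, `DBound₂ …` — the two row shapes (`b₁ = 1`, `b₁ = 2`) VERBATIM as Props, so a row theorem IS a term of them;
* **`pwin_holds_of_rows`** — from the four class bounds of a cell with `0 < u₁ < u₂ ≤ 85` and any `B ≤` each class constant:
  `PWin.Holds ⟨u1, u2, v1, v2, 0, B⟩` (the left end is strict automatically: equality would force `p ∣ n` and `u₂ ∣ u₁`; `bRay β1 = bC1` by
  `bC1_bridge`; `m ≥ 1` splits as `1 + 2t` / `2 + 2t`).  Per cell the bridge is then ONE term: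
  `pwin_holds_of_rows h₁ h₂ h₃ C137O1.bound C137E1.bound C137O2.bound C137E2.bound hB₁ hB₂ hB₃ hB₄` (numeric side goals by `norm_num`).
Cells touching `y = 0` (`u₁ = 0`) are excluded (`0 < u₁`): clip them to `[1/N, v)` on the producer side or use fam-rv's `RVPeriodicR0`.
-/

namespace Summit.KontsevichZagierPeriods.Zeta5Search.RayC1

open Summit.KontsevichZagierPeriods.Zeta5Search.CasoratianValuation (casoratian)
open Summit.KontsevichZagierPeriods.Zeta5Search.RVPeriodic (PWin)
open Summit.KontsevichZagierPeriods.Zeta5Search.T1Rays (bRay β1)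

/-- The row shape for the odd shifts `m = 1 + 2t` (parity class `n % 2 = r`), verbatim as fam-denom's `C…<E|O>1.bound`. -/
def DBound₁ (u1 u2 v1 v2 r : ℕ) (B : ℤ) : Prop :=
  ∀ {n p t : ℕ}, p.Prime → n % 2 = r → 85 * n + 2 < p ^ 2 →
    (u2 * 1 + u1) * p + 2 * u2 * (t * p) < u2 * n → v2 * n < (v2 * 1 + v1) * p + 2 * v2 * (t * p) →
    casoratian (bRay β1 n) 7 ≠ 0 → B - 256 * (1 + 2 * (t : ℤ)) ≤ padicValRat p (casoratian (bRay β1 n) 7)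

/-- The row shape for the even shifts `m = 2 + 2t` (parity class `n % 2 = r`), verbatim as fam-denom's `C…<E|O>2.bound`. -/
def DBound₂ (u1 u2 v1 v2 r : ℕ) (B : ℤ) : Prop :=
  ∀ {n p t : ℕ}, p.Prime → n % 2 = r → 85 * n + 2 < p ^ 2 →
    (u2 * 2 + u1) * p + 2 * u2 * (t * p) < u2 * n → v2 * n < (v2 * 2 + v1) * p + 2 * v2 * (t * p) →
    casoratian (bRay β1 n) 7 ≠ 0 → B - 256 * (2 + 2 * (t : ℤ)) ≤ padicValRat p (casoratian (bRay β1 n) 7)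

/-- **The bridge**: the four parity-class row bounds of a Farey cell `[u₁/u₂, v₁/v₂)` (`0 < u₁ < u₂ ≤ 85`) with class constants
`BO1, BE1, BO2, BE2` give fam-rv's periodic window statement `PWin.Holds ⟨u1, u2, v1, v2, 0, B⟩` for every `B` below all four. -/
theorem pwin_holds_of_rows {u1 u2 v1 v2 : ℕ} {B BO1 BE1 BO2 BE2 : ℤ} (hu1 : 0 < u1) (hu12 : u1 < u2) (hu2 : u2 ≤ 85)
    (hO1 : DBound₁ u1 u2 v1 v2 1 BO1) (hE1 : DBound₁ u1 u2 v1 v2 0 BE1)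
    (hO2 : DBound₂ u1 u2 v1 v2 1 BO2) (hE2 : DBound₂ u1 u2 v1 v2 0 BE2)
    (h1 : B ≤ BO1) (h2 : B ≤ BE1) (h3 : B ≤ BO2) (h4 : B ≤ BE2) :
    PWin.Holds ⟨u1, u2, v1, v2, 0, B⟩ := by
  intro n p m _ hpr hm hsq hA hB hne
  simp only at hA hB hne ⊢
  have hp0 : 0 < p := hpr.pos
  have hsq' : 85 * n + 2 < p ^ 2 := by rw [pow_two]; exact hsq
  -- `p > 85 ≥ u₂`: from `u₂ n ≥ (m u₂ + u₁) p ≥ u₂ p`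
  have hnp : p ≤ n := by
    have h1' : u2 * p ≤ (m * u2 + u1) * p := Nat.mul_le_mul_right p (by nlinarith)
    have h2' : u2 * p ≤ u2 * n := h1'.trans hA
    exact Nat.le_of_mul_le_mul_left h2' (by omega)
  have hp85 : 85 < p := by nlinarith
  -- strict left end
  have hA' : (m * u2 + u1) * p < u2 * n := by
    rcases hA.lt_or_eq with h | h
    · exact h
    · exfalso
      have hdvd : p ∣ u2 * n := ⟨m * u2 + u1, by rw [← h]; ring⟩
      rcases (Nat.Prime.dvd_mul hpr).1 hdvd with hu | hn
      · exact absurd (Nat.le_of_dvd (by omega) hu) (by omega)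
      · obtain ⟨q, rfl⟩ := hn
        have hq : m * u2 + u1 = u2 * q := by
          have : (m * u2 + u1) * p = (u2 * q) * p := by rw [h]; ring
          exact Nat.eq_of_mul_eq_mul_right hp0 this
        have hud : u2 ∣ u1 := ⟨q - m, by
          have hqm : m ≤ q := by
            by_contra hcon
            have : u2 * q < m * u2 + u1 := by nlinarith
            omega
          zify [hqm] at hq ⊢; linarith⟩
        exact absurd (Nat.le_of_dvd hu1 hud) (by omega)
  -- the ray of the rows is the ray of the consumer
  rw [← bC1_bridge] at hne ⊢
  -- parity split of `m ≥ 1` and of `n`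
  obtain ⟨t, ht⟩ : ∃ t, m = 1 + 2 * t ∨ m = 2 + 2 * t := ⟨(m - 1) / 2, by omega⟩
  rcases Nat.mod_two_eq_zero_or_one n with hn2 | hn2 <;> rcases ht with rfl | rfl
  · have hA2 : (u2 * 1 + u1) * p + 2 * u2 * (t * p) < u2 * n := by
      have e : (u2 * 1 + u1) * p + 2 * u2 * (t * p) = ((1 + 2 * t) * u2 + u1) * p := by ring
      rw [e]; exact hA'
    have hB2 : v2 * n < (v2 * 1 + v1) * p + 2 * v2 * (t * p) := by
      have e : (v2 * 1 + v1) * p + 2 * v2 * (t * p) = ((1 + 2 * t) * v2 + v1) * p := by ring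
      rw [e]; exact hB
    have := hE1 hpr hn2 hsq' hA2 hB2 hne
    push_cast; linarith
  · have hA2 : (u2 * 2 + u1) * p + 2 * u2 * (t * p) < u2 * n := by
      have e : (u2 * 2 + u1) * p + 2 * u2 * (t * p) = ((2 + 2 * t) * u2 + u1) * p := by ring
      rw [e]; exact hA'
    have hB2 : v2 * n < (v2 * 2 + v1) * p + 2 * v2 * (t * p) := by
      have e : (v2 * 2 + v1) * p + 2 * v2 * (t * p) = ((2 + 2 * t) * v2 + v1) * p := by ring
      rw [e]; exact hB
    have := hE2 hpr hn2 hsq' hA2 hB2 hne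
    push_cast; linarith
  · have hA2 : (u2 * 1 + u1) * p + 2 * u2 * (t * p) < u2 * n := by
      have e : (u2 * 1 + u1) * p + 2 * u2 * (t * p) = ((1 + 2 * t) * u2 + u1) * p := by ring
      rw [e]; exact hA'
    have hB2 : v2 * n < (v2 * 1 + v1) * p + 2 * v2 * (t * p) := by
      have e : (v2 * 1 + v1) * p + 2 * v2 * (t * p) = ((1 + 2 * t) * v2 + v1) * p := by ring
      rw [e]; exact hB
    have := hO1 hpr hn2 hsq' hA2 hB2 hne
    push_cast; linarith
  · have hA2 : (u2 * 2 + u1) * p + 2 * u2 * (t * p) < u2 * n := by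
      have e : (u2 * 2 + u1) * p + 2 * u2 * (t * p) = ((2 + 2 * t) * u2 + u1) * p := by ring
      rw [e]; exact hA'
    have hB2 : v2 * n < (v2 * 2 + v1) * p + 2 * v2 * (t * p) := by
      have e : (v2 * 2 + v1) * p + 2 * v2 * (t * p) = ((2 + 2 * t) * v2 + v1) * p := by ring
      rw [e]; exact hB
    have := hO2 hpr hn2 hsq' hA2 hB2 hne
    push_cast; linarith

end Summit.KontsevichZagierPeriods.Zeta5Search.RayC1
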